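import Summits.BirchSwinnertonDyer.BirchSwinnertonDyer.Theorems.ByReductionTypeAtTwoAdditivePotGoodPrintFamily56b1Descent
import Literature.NumberTheory.EllipticCurves.ShaPrimaryIsogenyProofs
import Literature.NumberTheory.EllipticCurves.ComplexMultiplicationBurungaleFlachProofs
import HarnessLib

/-!
# K4 crux `AdditiveRankZeroAtTwo` (19098), children C3″ (22617) / C2″ (22616): **`Ш(56b1/ℚ)[2^∞] = 0` IN THE KERNEL**,
# and the `56b1` Thm-1.5 road with `BSD(56b1, 2)` reduced to the single record `ord₂ #Ш_an(56b1) = 0`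

Cell `bsd-2adic`, seat `bsd-2adic-k4-w2` GEN 5 (prover, explicit unit, no kit); `--supports stmt-BirchSwinnertonDyer-22617
--as helper`. HONEST FRAMING (D-0036/D-0054): `…PrintFamily56b1Descent.lean` (p682659) left three displayed base records on
the `56b1` Thm-1.5 road: the optimal datum, `ord₂ L^alg(56b1) = −1`, and Miller's `BSD(56b1, 2)`. THIS FILE: (§1) the descent
via `2`-isogeny on the translated model `Y₀ = [0,5,0,8,0]` of `56b1` itself is sharp too — `S(5,8) ⊆ {1,2}` (classes `−1`, `−2`
die modulo `7`), `S′(5,8) = S(−10,−7) ⊆ {1,−7}` (the Descent file) — so `Ш(Y₀)[2] = 0`; (§2) transported to the minimal model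
along the translation (an isogeny of degree `1`, tree `Isogeny.natCard_primaryComponent_sha_eq`): **`Ш(56b1/ℚ)[2^∞] = 0`**,
unconditionally, in the kernel (CLZ print: «`A(ℚ) = ℤ/2ℤ`», BSD predicts `Ш(56b1) = 0`); (§3) hence Miller's `BSD(56b1, 2)`
follows from modularity, the record `ord₂(L(56b1,1)/Ω) = −1` (giving `r_an = 0`; `rank = 0` is the Descent file's kernel
theorem) and the ONE record `ord₂ #Ш_an(56b1) = 0` (`#Ш_an = L(1)·#tors²/(Ω·Tam·Reg)`; the kernel does not yet evaluate
`Tam(56b1)` and `#tors`); (§4) `printFamily56b1_of_thm15_certified'` — the road with `hbase` replaced by that record.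
Closes nothing at the `∀`-level; BSD is not proved by any of this.

References: [SilvermanAEC2009] Prop. X.4.7, X.4.9, Example X.4.10; [MilneADT2006] Ch. I Lemma 7.1(b); [Miller2011LMS] Def. 1.1;
[CaiLiZhai2019] Thm. 1.1, 1.5, §6.2.2.
-/

set_option autoImplicit false
set_option linter.dupNamespace false

noncomputable section

open scoped Classical

open WeierstrassCurve Literature.NumberTheory.EllipticCurves
  Literature.NumberTheory.EllipticCurves.Rank1Residual
  Literature.NumberTheory.EllipticCurves.Rank1Residual.Typed
  Literature.NumberTheory.EllipticCurves.CaiLiZhai2019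
  Literature.NumberTheory.EllipticCurves.ModularForms
  Literature.NumberTheory.EllipticCurves.AgasheRibetStein2006
  Summit.BirchSwinnertonDyer.Rank1Residual
  Summit.BirchSwinnertonDyer.Rank1Residual.X5.O1
  Summit.BirchSwinnertonDyer.Rank1Residual.P2

namespace Summit.BirchSwinnertonDyer.BirchSwinnertonDyer.Theorems.AddPotGoodPrint

/-! ## §1 The sharp descent on `Y₀ = [0,5,0,8,0]` (`56b1` translated by `x ↦ x + 2`) -/

/-- `b(a² − 4b) = 8·(−7) ≠ 0` for `Y₀ = E_{5,8}`. [cite: SilvermanAEC2009, Prop. X.4.9] -/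
theorem habY₀ : (8 : ℤ) * ((5 : ℤ) ^ 2 - 4 * 8) ≠ 0 := by norm_num

/-- The tree's literal `E_{5,8}` is `Y₀ = [0,5,0,8,0]`. [cite: SilvermanAEC2009, Prop. X.4.9] -/
private theorem lit_Y₀ : (⟨0, ((5 : ℤ) : ℚ), 0, ((8 : ℤ) : ℚ), 0⟩ : WeierstrassCurve ℚ) = ⟨0, 5, 0, 8, 0⟩ := by
  ext <;> push_cast <;> ring

/-- The half-model literal for `(a,b) = (5,8)` is `[0,−5/2,0,−7/16,0]`. [cite: SilvermanAEC2009, Prop. X.4.9] -/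
private theorem lit_V₀Y₀ :
    (⟨0, -((5 : ℤ) : ℚ) / 2, 0, (((5 : ℤ) : ℚ) ^ 2 - 4 * (8 : ℤ)) / 16, 0⟩ : WeierstrassCurve ℚ) =
      ⟨0, -5 / 2, 0, -7 / 16, 0⟩ := by
  ext <;> push_cast <;> ring

/-- The half-model `[0,−5/2,0,−7/16,0]` is an elliptic curve. [cite: SilvermanAEC2009, Prop. X.4.9] -/
theorem isElliptic_V₀Y₀ : (⟨0, -5 / 2, 0, -7 / 16, 0⟩ : WeierstrassCurve ℚ).IsElliptic := by
  rw [← lit_V₀Y₀]; exact isElliptic_halfModel habY₀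

/-- `S(5, 8)` does not contain `d = −1, −2`: neither chart of the homogeneous space has a point modulo `7`.
[cite: SilvermanAEC2009, Example X.4.10 (the congruence method)] -/
theorem not_mem_S_Y₀ :
    (-1 : ℤ) ∉ twoIsogenySelmerGroup 5 8 ∧ (-2 : ℤ) ∉ twoIsogenySelmerGroup 5 8 := by
  have hB : (8 : ℤ) ≠ 0 := by norm_num
  haveI : Fact (Nat.Prime 7) := ⟨by norm_num⟩
  refine ⟨?_, ?_⟩
  · refine Carrier6137.not_mem_twoIsogenySelmerGroup_of_not_isSoluble hB 7 ?_
    rw [show (8 : ℤ) / -1 = -8 by norm_num]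
    exact Carrier6137.not_isSoluble_padic_twoIsogenyQuartic_of_zmodPow 1 (by decide)
  · refine Carrier6137.not_mem_twoIsogenySelmerGroup_of_not_isSoluble hB 7 ?_
    rw [show (8 : ℤ) / -2 = -4 by norm_num]
    exact Carrier6137.not_isSoluble_padic_twoIsogenyQuartic_of_zmodPow 1 (by decide)

/-- A squarefree integer dividing `8` is `±1` or `±2`. [cite: SilvermanAEC2009, Prop. X.4.9] -/
private theorem mem_of_dvd_eight {d : ℤ} (hsq : Squarefree d) (hd : d ∣ (8 : ℤ)) :
    d ∈ ({1, -1, 2, -2} : Finset ℤ) := by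
  have hrad : d ∣ 2 := by
    have h3 : d ∣ (2 : ℤ) ^ 3 := by norm_num at hd ⊢; exact hd
    exact (hsq.dvd_pow_iff_dvd (by norm_num)).mp h3
  have h1 : d.natAbs ∣ 2 := by
    have := Int.natAbs_dvd_natAbs.mpr hrad
    simpa using this
  have h2 : d.natAbs ∈ Nat.divisors 2 := Nat.mem_divisors.mpr ⟨h1, by norm_num⟩
  rw [show Nat.divisors 2 = {1, 2} by decide] at h2
  simp only [Finset.mem_insert, Finset.mem_singleton] at h2 ⊢
  rcases Int.natAbs_eq d with h | h <;> rw [h] <;> rcases h2 with h2 | h2 <;> simp [h2]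

/-- **`S(5, 8) ⊆ {1, 2}`** (the images of `O` and `T = (0,0)`). [cite: SilvermanAEC2009, Prop. X.4.9 and Example X.4.10] -/
theorem twoIsogenySelmerGroup_Y₀_subset : twoIsogenySelmerGroup 5 8 ⊆ ({1, 2} : Finset ℤ) := by
  intro d hd
  obtain ⟨hsq, hdvd, -⟩ := (mem_twoIsogenySelmerGroup_iff (a := 5) (by norm_num : (8 : ℤ) ≠ 0)).mp hd
  have hmem := mem_of_dvd_eight hsq hdvd
  obtain ⟨hm1, hm2⟩ := not_mem_S_Y₀
  simp only [Finset.mem_insert, Finset.mem_singleton] at hmem ⊢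
  rcases hmem with rfl | rfl | rfl | rfl
  · simp
  · exact absurd hd hm1
  · simp
  · exact absurd hd hm2

/-- `2^k ≤ 2^n` forces `k ≤ n`. [folklore] -/
private theorem le_of_two_pow_le' {k n : ℕ} (h : 2 ^ k ≤ 2 ^ n) : k ≤ n :=
  (Nat.pow_le_pow_iff_right (by norm_num)).mp h

/-- **`dim₂ S(5,8) ≤ 1` and `dim₂ S′(5,8) = dim₂ S(−10,−7) ≤ 1`** (the second is the Descent file's bound for `E′`).
[cite: SilvermanAEC2009, Prop. X.4.9] -/
theorem twoIsogenySelmerRank_Y₀_le : twoIsogenySelmerRank 5 8 ≤ 1 ∧ twoIsogenySelmerRank' 5 8 ≤ 1 := by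
  constructor
  · apply le_of_two_pow_le'
    rw [two_pow_twoIsogenySelmerRank_eq_card habY₀]
    exact (Finset.card_le_card twoIsogenySelmerGroup_Y₀_subset).trans (by decide)
  · apply le_of_two_pow_le'
    rw [two_pow_twoIsogenySelmerRank'_eq_card habY₀, twoIsogenySelmerGroup'_eq,
      show (-2 * 5 : ℤ) = -10 by norm_num, show ((5 : ℤ) ^ 2 - 4 * 8 : ℤ) = -7 by norm_num]
    exact (Finset.card_le_card twoIsogenySelmerGroup_E'_subset).trans (by decide)

/-- **`Ш(Y₀/ℚ)[2] = 0`** for the translated model `Y₀ = [0,5,0,8,0]` of `56b1` (sharp descent).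
[cite: SilvermanAEC2009, Prop. X.4.7 with Thm. X.4.2(a)] -/
theorem forall_mem_sha_Y₀_two_smul_eq_zero :
    ∀ c ∈ (⟨0, 5, 0, 8, 0⟩ : WeierstrassCurve ℚ).sha, 2 • c = 0 → c = 0 := by
  haveI : (⟨0, -((5 : ℤ) : ℚ) / 2, 0, (((5 : ℤ) : ℚ) ^ 2 - 4 * (8 : ℤ)) / 16, 0⟩ :
      WeierstrassCurve ℚ).IsElliptic := by rw [lit_V₀Y₀]; exact isElliptic_V₀Y₀
  haveI : (⟨0, ((5 : ℤ) : ℚ), 0, ((8 : ℤ) : ℚ), 0⟩ : WeierstrassCurve ℚ).IsElliptic := by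
    rw [lit_Y₀]; exact isElliptic_V₀E'
  have hsharp : twoIsogenySelmerRank 5 8 + twoIsogenySelmerRank' 5 8 ≤
      (⟨0, ((5 : ℤ) : ℚ), 0, ((8 : ℤ) : ℚ), 0⟩ : WeierstrassCurve ℚ).mordellWeilRank + 2 := by
    have h := twoIsogenySelmerRank_Y₀_le
    omega
  have h := forall_mem_sha_two_smul_eq_zero_of_selmerRank_add_le (a := 5) (b := 8) habY₀ hsharp
  rwa [lit_Y₀] at h

/-! ## §2 `Ш(56b1/ℚ)[2^∞] = 0` -/

/-- `Ш(Y₀)(2) = ⊥` for the translated model, stated on `(1,2,0,0) • 56b1` literally. [cite: SilvermanAEC2009, Prop. X.4.7] -/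
theorem primaryComponent_sha_shift_C56B1_eq_bot :
    AddCommGroup.primaryComponent ((⟨1, 2, 0, 0⟩ : VariableChange ℚ) • C56B1).sha 2 = ⊥ := by
  have h : ∀ c ∈ ((⟨1, 2, 0, 0⟩ : VariableChange ℚ) • C56B1).sha, 2 • c = 0 → c = 0 := by
    rw [shift_C56B1_eq]; exact forall_mem_sha_Y₀_two_smul_eq_zero
  exact primaryComponent_sha_eq_bot_of_forall _ h

/-- **`#Ш(56b1/ℚ)[2^∞] = 1` — IN THE KERNEL** (transport along the translation, an isogeny of degree `1`: tree
`Isogeny.natCard_primaryComponent_sha_eq`). [cite: MilneADT2006, Ch. I Lemma 7.1(b)] [cite: CaiLiZhai2019, §6.2.2] -/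
theorem natCard_primaryComponent_sha_C56B1_two [C56B1.IsElliptic] :
    Nat.card (AddCommGroup.primaryComponent C56B1.sha 2) = 1 := by
  haveI : Fact (Nat.Prime 2) := ⟨Nat.prime_two⟩
  have h := (VariableChange.toIsogeny C56B1 (⟨1, 2, 0, 0⟩ : VariableChange ℚ)).natCard_primaryComponent_sha_eq 2
    (by rw [VariableChange.degree_toIsogeny]; norm_num)
  rw [h, primaryComponent_sha_shift_C56B1_eq_bot, AddSubgroup.card_bot]

/-- **`Ш(56b1/ℚ)[2^∞] = 0` — unconditionally, in the kernel.** [cite: MilneADT2006, Ch. I Lemma 7.1(b)] [cite: SilvermanAEC2009, Prop. X.4.7] -/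
theorem primaryComponent_sha_C56B1_two_eq_bot [C56B1.IsElliptic] :
    AddCommGroup.primaryComponent C56B1.sha 2 = ⊥ := by
  haveI := finite_primaryComponent_sha_C56B1_two
  exact AddSubgroup.eq_bot_of_card_eq _ natCard_primaryComponent_sha_C56B1_two

/-! ## §3 Miller's `BSD(56b1, 2)` from two records -/

/-- **`r_an(56b1) = 0`** from modularity and the record `L(56b1,1) = q·Ω`, `ord₂ q = −1` (so `L(56b1,1) ≠ 0`).
[cite: CaiLiZhai2019, §6.2.2 (L^alg(A,1) ≠ 0)] -/
theorem analyticRank_C56B1 (hmod : hasEntireLFunction_rat) [C56B1.IsElliptic]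
    (hL : ∃ q : ℚ, C56B1.entireLFunction 1 = (q : ℂ) * (C56B1.realPeriodRat : ℂ) ∧ padicValRat 2 q = -1) :
    C56B1.analyticRank = 0 := by
  obtain ⟨q, hq, hv⟩ := hL
  have hq0 : q ≠ 0 := by rintro rfl; simp at hv
  have hΩ : C56B1.realPeriodRat ≠ 0 := ne_of_gt C56B1.realPeriodRat_pos_holds
  refine (C56B1.analyticRank_eq_zero_iff_holds (hmod C56B1)).mpr ?_
  rw [hq]
  exact mul_ne_zero (by exact_mod_cast hq0) (by exact_mod_cast hΩ)

/-- **Miller's `BSD(56b1, 2)` from modularity, the record `ord₂(L(56b1,1)/Ω) = −1` and the record `ord₂ #Ш_an(56b1) = 0`**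
(kernel: `rank 56b1 = 0`, `Ш(56b1)[2^∞] = 0`). [cite: Miller2011LMS, Def. 1.1] -/
theorem bsdp_two_C56B1_of_shaAn (hmod : hasEntireLFunction_rat) [C56B1.IsElliptic]
    (hL : ∃ q : ℚ, C56B1.entireLFunction 1 = (q : ℂ) * (C56B1.realPeriodRat : ℂ) ∧ padicValRat 2 q = -1)
    (hShaAn : ∃ q : ℚ, shaAn C56B1 = (q : ℂ) ∧ padicValRat 2 q = 0) : BSDp C56B1 2 := by
  obtain ⟨q, hq, hv⟩ := hShaAn
  refine ⟨by rw [mordellWeilRank_C56B1, analyticRank_C56B1 hmod hL], finite_primaryComponent_sha_C56B1_two, q, hq, ?_⟩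
  rw [natCard_primaryComponent_sha_C56B1_two, hv]
  simp

/-! ## §4 The `56b1` Thm-1.5 road with two numeric records and the optimal datum -/

/-- **BSD₂ (both K4 halves, `Ш(W)(2) = 0`) on the `2N`-split sub-family of `56b1^{(∏Q)}`**, displaying: the optimal datum
(`Dt`, `hopt`), `ord₂(L(56b1,1)/Ω) = −1` (`hL`), `ord₂ #Ш_an(56b1) = 0` (`hShaAn`); everything else (`#E(ℚ)[2] = 2`, the
`2`-isogeny and `#ker = 2`, `Ш(E′)[2] = 0`, `rank 56b1 = 0`, `Ш(56b1)[2^∞] = 0`, habitat) in the kernel; inputs BY NAME CLZ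
Thm. 1.1/1.5, ARS Thm. 2.6, modularity, GZK. BSD is not proved by any of this.
[cite: CaiLiZhai2019, Thm. 1.1 and Thm. 1.5] [cite: AgasheRibetStein2006, Thm. 2.6] [cite: Miller2011LMS, Def. 1.1] -/
theorem printFamily56b1_of_thm15_certified' (h11 : thm11_ord_two_LAlg_twist) (h15 : thm15_twoPartBSD_twist)
    (h26 : cremona_abs_maninConstant_eq_one_of_level_le) (hmod : hasEntireLFunction_rat)
    (hGZK : rank_eq_analyticRank_of_analyticRank_le_one)
    [C56B1.IsElliptic] [C56B1.IsGloballyMinimal] [NeZero (C56B1.conductorNorm ℤ)]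
    (Dt : ModularParametrizationData C56B1 (C56B1.conductorNorm ℤ))
    (hopt : ∀ z ∈ Dt.L.lattice, ∃ w ∈ periodLattice Dt.f, z = Dt.c * w)
    (hL : ∃ q : ℚ, C56B1.entireLFunction 1 = (q : ℂ) * (C56B1.realPeriodRat : ℂ) ∧ padicValRat 2 q = -1)
    (hShaAn : ∃ q : ℚ, shaAn C56B1 = (q : ℂ) ∧ padicValRat 2 q = 0)
    (Q : Finset ℕ) (hQ : Q.Nonempty) (hS : ∀ q ∈ Q, InS C56B1 q)
    (hsplit : ∀ (K : Type) [Field K] [NumberField K], Module.finrank ℚ K = 2 →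
      (∃ x : K, x ^ 2 = ((∏ q ∈ Q, q : ℕ) : K)) → SatisfiesHeegnerHypothesis (2 * C56B1.conductorNorm ℤ) K)
    (W : WeierstrassCurve ℚ) [W.IsElliptic] [W.IsGloballyMinimal]
    (hW : ∃ C : VariableChange ℚ, C • C56B1.quadraticTwist ((∏ q ∈ Q, q : ℕ) : ℚ) = W) :
    W.analyticRank = 0 ∧ Addv W 2 ∧ 0 ≤ padicValRat 2 W.j ∧ ¬ W.HasCM ∧ Red W 2 ∧
      AddCommGroup.primaryComponent W.sha 2 = ⊥ ∧ BSDp W 2 ∧ MissingLowerBoundAt W 2 ∧ MissingUpperBoundAt W 2 :=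
  printFamily56b1_of_thm15_certified h11 h15 h26 hmod hGZK Dt hopt hL (bsdp_two_C56B1_of_shaAn hmod hL hShaAn) Q hQ hS
    hsplit W hW

end Summit.BirchSwinnertonDyer.BirchSwinnertonDyer.Theorems.AddPotGoodPrint

end
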